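import Literature.NumberTheory.ConnesMoscovici2022.UVProlateEigenfunctionEndpoint
import Mathlib.MeasureTheory.Integral.IntegralEqImproper
import Mathlib.Analysis.SpecialFunctions.ImproperIntegrals
import HarnessLib

/-!
# Connes–Moscovici 2022, Corollary 1.7 (ii): asymptotics of the eigenfunctions of `W_sa` at `+∞`,
# and the discharge `CM22_cor_1_7_holds`

Topic `Literature/NumberTheory/ConnesMoscovici2022`; companion of `UVProlateSpectrum.lean` (named fact
`CM22_cor_1_7` = [ConnesMoscovici2022, Cor 1.7] = arXiv:2112.05500 Cor 2.7) and of
`UVProlateEigenfunctionEndpoint.lean` (clause (i)).  The printed proof ("This follows from the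
characterization (1.19)–(1.21) of the domain of `W_sa` combined with the known bases of formal solutions
for `Wξ = μξ` around `±λ` and `±∞` [ramisrecent]") is replaced, for clause (ii), by an elementary
OSCULATING-CONSTANTS argument that needs no formal-solution theory at the irregular singular point:

* `exists_tendsto_osc_of_tendsto_osc_zero` — abstract lemma: if `v ∈ C²(x₀,∞)` satisfies
  `‖v″ + ω²v‖ ≤ c(x)(‖v‖ + ‖v′‖)` with `c ≥ 0` continuous and integrable, and the osculating constant
  `α_θ = cos(ωx+θ₀) v − sin(ωx+θ₀) v′/ω → 0`, then `β_θ = sin(ωx+θ₀) v + cos(ωx+θ₀) v′/ω` converges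
  (`β′ = (cos θ/ω)(v″ + ω²v)`, a small tail of `∫c` bounds `sup|β|`, so `β′ ∈ L¹`).
* `prolate_v_identity`, `prolate_v_forcing_bound` — for `g` smooth off `±λ` with `(p g′)′ = (q − μ) g`
  (`p = λ² − x²`, `q = (2πλx)²`), `v = x g` satisfies `p(v″ + ω²v) = 2λ² g′ + (ω²λ² − μ) v`, `ω = 2πλ`,
  whence `‖v″ + ω²v‖ ≤ (K/x²)(‖v‖ + ‖v′‖)` for `x > max(2λ, 1)`.
* `bcInfEven_eq_osc`, `bcInfOdd_eq_osc` — the printed boundary expressions (1.20), (1.21) ARE the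
  osculating constants: `bcInfEven λ g = −ω α₀`, `bcInfOdd λ g = −ω α_{π/2}`; so the boundary
  conditions at `+∞` say `α₀ → 0` (even sector), `α_{π/2} → 0` (odd sector).
* `exists_isLittleO_of_osc_tendsto_zero` — `g(x) = A sin(ωx + θ₀)/x + o(1/x)`.
* **`CM22_cor_1_7_holds : CM22_cor_1_7`** — both clauses as typed ((i) imported; (ii): `θ₀ = 0` gives
  `sin(2πλx)/x` for a.e.-even representatives, `θ₀ = π/2` gives `cos(2πλx)/x` for a.e.-odd ones; an
  a.e. parity relation holds pointwise off `±λ` by continuity, so the printed conditions on `ξ^±`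
  transfer to `g`).

RH-context: RH-FREE corpus literature (CM22 §1 sequel row, no leaf role); nothing here bears on the
truth of RH.
-/

noncomputable section

open Complex Set MeasureTheory Filter Topology intervalIntegral
open scoped Real Topology ContDiff

namespace Literature.NumberTheory.ConnesMoscovici2022

/-! ## Osculating constants for `v″ + w² v = small`: an abstract asymptotic lemma -/

section Osculating

/-- `cos² + sin²  = 1`, complexified (plumbing). [folklore] -/
private theorem cos_sq_add_sin_sq_ofReal (t : ℝ) :
    ((Real.cos t : ℝ) : ℂ) ^ 2 + ((Real.sin t : ℝ) : ℂ) ^ 2 = 1 := by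
  exact_mod_cast Real.cos_sq_add_sin_sq t

/-- Reconstruction of `v` from the osculating constants:
`v = cos θ · α + sin θ · β` (`α = cos θ v − sin θ v′/w`, `β = sin θ v + cos θ v′/w`). [folklore] -/
private theorem osc_reconstruct {w : ℝ} (hw : w ≠ 0) (t : ℝ) (v v' : ℂ) :
    ((Real.cos t : ℝ) : ℂ) * ((Real.cos t : ℂ) * v - (Real.sin t : ℂ) * v' / w) +
      ((Real.sin t : ℝ) : ℂ) * ((Real.sin t : ℂ) * v + (Real.cos t : ℂ) * v' / w) = v := by
  have h := cos_sq_add_sin_sq_ofReal t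
  have hw' : (w : ℂ) ≠ 0 := Complex.ofReal_ne_zero.2 hw
  field_simp
  linear_combination v * (w : ℂ) * h

/-- Reconstruction of `v′`: `v′ = w (−sin θ · α + cos θ · β)`. [folklore] -/
private theorem osc_reconstruct_deriv {w : ℝ} (hw : w ≠ 0) (t : ℝ) (v v' : ℂ) :
    (w : ℂ) * (-((Real.sin t : ℝ) : ℂ) * ((Real.cos t : ℂ) * v - (Real.sin t : ℂ) * v' / w) +
      ((Real.cos t : ℝ) : ℂ) * ((Real.sin t : ℂ) * v + (Real.cos t : ℂ) * v' / w)) = v' := by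
  have h := cos_sq_add_sin_sq_ofReal t
  have hw' : (w : ℂ) ≠ 0 := Complex.ofReal_ne_zero.2 hw
  field_simp
  linear_combination v' * h

/-- Norm bounds from the reconstruction: `‖v‖ ≤ ‖α‖ + ‖β‖`. [folklore] -/
private theorem norm_le_osc {w : ℝ} (hw : w ≠ 0) (t : ℝ) (v v' : ℂ) :
    ‖v‖ ≤ ‖(Real.cos t : ℂ) * v - (Real.sin t : ℂ) * v' / w‖ +
      ‖(Real.sin t : ℂ) * v + (Real.cos t : ℂ) * v' / w‖ := by
  conv_lhs => rw [← osc_reconstruct hw t v v']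
  refine (norm_add_le _ _).trans (add_le_add ?_ ?_)
  · rw [norm_mul]
    refine mul_le_of_le_one_left (norm_nonneg _) ?_
    rw [Complex.norm_real, Real.norm_eq_abs]; exact Real.abs_cos_le_one t
  · rw [norm_mul]
    refine mul_le_of_le_one_left (norm_nonneg _) ?_
    rw [Complex.norm_real, Real.norm_eq_abs]; exact Real.abs_sin_le_one t

/-- `‖v′‖ ≤ |w| (‖α‖ + ‖β‖)`. [folklore] -/
private theorem norm_deriv_le_osc {w : ℝ} (hw : w ≠ 0) (t : ℝ) (v v' : ℂ) :
    ‖v'‖ ≤ |w| * (‖(Real.cos t : ℂ) * v - (Real.sin t : ℂ) * v' / w‖ +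
      ‖(Real.sin t : ℂ) * v + (Real.cos t : ℂ) * v' / w‖) := by
  conv_lhs => rw [← osc_reconstruct_deriv hw t v v']
  rw [norm_mul, Complex.norm_real, Real.norm_eq_abs]
  refine mul_le_mul_of_nonneg_left ((norm_add_le _ _).trans (add_le_add ?_ ?_)) (abs_nonneg _)
  · rw [norm_mul, norm_neg]
    refine mul_le_of_le_one_left (norm_nonneg _) ?_
    rw [Complex.norm_real, Real.norm_eq_abs]; exact Real.abs_sin_le_one t
  · rw [norm_mul]
    refine mul_le_of_le_one_left (norm_nonneg _) ?_
    rw [Complex.norm_real, Real.norm_eq_abs]; exact Real.abs_cos_le_one t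

/-- The derivative of the second osculating constant:
`β′ = (cos θ/w)(v″ + w² v)`, `θ = wx + θ₀`. [folklore] -/
private theorem hasDerivAt_oscB {w θ₀ : ℝ} (hw : w ≠ 0) {v v' : ℝ → ℂ} {v'' : ℂ} {x : ℝ}
    (hv : HasDerivAt v (v' x) x) (hv' : HasDerivAt v' v'' x) :
    HasDerivAt (fun y => (Real.sin (w * y + θ₀) : ℂ) * v y + (Real.cos (w * y + θ₀) : ℂ) * v' y / w)
      ((Real.cos (w * x + θ₀) : ℂ) / w * (v'' + (w : ℂ) ^ 2 * v x)) x := by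
  have hθ : HasDerivAt (fun y : ℝ => w * y + θ₀) w x := by
    simpa using ((hasDerivAt_id x).const_mul w).add_const θ₀
  have hs : HasDerivAt (fun y : ℝ => ((Real.sin (w * y + θ₀) : ℝ) : ℂ))
      (((Real.cos (w * x + θ₀) * w : ℝ) : ℂ)) x :=
    ((Real.hasDerivAt_sin _).comp x hθ).ofReal_comp
  have hc : HasDerivAt (fun y : ℝ => ((Real.cos (w * y + θ₀) : ℝ) : ℂ))
      (((-Real.sin (w * x + θ₀) * w : ℝ) : ℂ)) x :=
    ((Real.hasDerivAt_cos _).comp x hθ).ofReal_comp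
  have h := (hs.fun_mul hv).fun_add ((hc.fun_mul hv').div_const (w : ℂ))
  refine h.congr_deriv ?_
  push_cast
  have hw' : (w : ℂ) ≠ 0 := Complex.ofReal_ne_zero.2 hw
  field_simp
  ring

/-- **Abstract asymptotic lemma (osculating constants).**  Let `v ∈ C²(x₀, ∞)` satisfy
`‖v″ + w² v‖ ≤ c(x)(‖v‖ + ‖v′‖)` with `c ≥ 0` continuous and integrable on `(x₀, ∞)`.  If the
osculating constant `α = cos θ · v − sin θ · v′/w` (`θ = wx + θ₀`) tends to `0` at `+∞`, then the
other one `β = sin θ · v + cos θ · v′/w` converges.  (So `v = A sin θ + o(1)`: the boundary condition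
selects the phase.)  Mechanism: `β′ = (cos θ/w)(v″ + w²v)`, `|β′| ≤ c̃(|α| + |β|)`; a small tail of
`∫ c̃` bounds `sup |β|`, whence `β′ ∈ L¹`.
[cite: ConnesMoscovici2022, Cor 1.7 (ii) (= arXiv:2112.05500 Cor 2.7, chunk p0006:L116–L123; proof p0007:L1–L4)] -/
theorem exists_tendsto_osc_of_tendsto_osc_zero {w θ₀ x₀ : ℝ} (hw : 0 < w) {v v' v'' : ℝ → ℂ}
    (hv : ∀ x ∈ Ioi x₀, HasDerivAt v (v' x) x) (hv' : ∀ x ∈ Ioi x₀, HasDerivAt v' (v'' x) x)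
    (hv''c : ContinuousOn v'' (Ioi x₀)) {c : ℝ → ℝ} (hcc : ContinuousOn c (Ioi x₀))
    (hc0 : ∀ x ∈ Ioi x₀, 0 ≤ c x) (hcint : IntegrableOn c (Ioi x₀))
    (hF : ∀ x ∈ Ioi x₀, ‖v'' x + (w : ℂ) ^ 2 * v x‖ ≤ c x * (‖v x‖ + ‖v' x‖))
    (hα : Tendsto (fun x => (Real.cos (w * x + θ₀) : ℂ) * v x - (Real.sin (w * x + θ₀) : ℂ) * v' x / w)
      atTop (𝓝 0)) :
    ∃ A : ℂ, Tendsto (fun x => (Real.sin (w * x + θ₀) : ℂ) * v x + (Real.cos (w * x + θ₀) : ℂ) * v' x / w)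
      atTop (𝓝 A) := by
  have hw0 : w ≠ 0 := hw.ne'
  set α : ℝ → ℂ := fun x => (Real.cos (w * x + θ₀) : ℂ) * v x - (Real.sin (w * x + θ₀) : ℂ) * v' x / w
    with hα_def
  set β : ℝ → ℂ := fun x => (Real.sin (w * x + θ₀) : ℂ) * v x + (Real.cos (w * x + θ₀) : ℂ) * v' x / w
    with hβ_def
  set β' : ℝ → ℂ := fun x => (Real.cos (w * x + θ₀) : ℂ) / w * (v'' x + (w : ℂ) ^ 2 * v x) with hβ'_def
  have hβd : ∀ x ∈ Ioi x₀, HasDerivAt β (β' x) x := fun x hx =>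
    hasDerivAt_oscB (θ₀ := θ₀) hw0 (hv x hx) (hv' x hx)
  -- continuity
  have hvc : ContinuousOn v (Ioi x₀) := fun x hx => (hv x hx).continuousAt.continuousWithinAt
  have hv'c : ContinuousOn v' (Ioi x₀) := fun x hx => (hv' x hx).continuousAt.continuousWithinAt
  have hβc : ContinuousOn β (Ioi x₀) := by
    rw [hβ_def]
    exact ((Complex.continuous_ofReal.comp (Real.continuous_sin.comp (by fun_prop))).continuousOn.mul
      hvc).add (((Complex.continuous_ofReal.comp (Real.continuous_cos.comp (by fun_prop))).continuousOn.mul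
      hv'c).div_const _)
  have hβ'c : ContinuousOn β' (Ioi x₀) := by
    rw [hβ'_def]
    exact ((Complex.continuous_ofReal.comp (Real.continuous_cos.comp (by fun_prop))).continuousOn.div_const
      _).mul (hv''c.add (continuousOn_const.mul hvc))
  -- the differential inequality  ‖β′‖ ≤ c̃ (‖α‖ + ‖β‖),  c̃ = c (1 + w)/w
  set ct : ℝ → ℝ := fun x => c x * ((1 + w) / w) with hct
  have hct0 : ∀ x ∈ Ioi x₀, 0 ≤ ct x := fun x hx => by rw [hct]; exact mul_nonneg (hc0 x hx) (by positivity)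
  have hctc : ContinuousOn ct (Ioi x₀) := hcc.mul continuousOn_const
  have hβ'le : ∀ x ∈ Ioi x₀, ‖β' x‖ ≤ ct x * (‖α x‖ + ‖β x‖) := by
    intro x hx
    have h1 : ‖β' x‖ ≤ 1 / w * (c x * (‖v x‖ + ‖v' x‖)) := by
      rw [hβ'_def]; dsimp only
      rw [norm_mul, norm_div, Complex.norm_real, Complex.norm_real, Real.norm_eq_abs, Real.norm_eq_abs,
        abs_of_pos hw]
      exact mul_le_mul (div_le_div_of_nonneg_right (Real.abs_cos_le_one _) hw.le) (hF x hx)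
        (norm_nonneg _) (by positivity)
    have h2 : ‖v x‖ + ‖v' x‖ ≤ (1 + w) * (‖α x‖ + ‖β x‖) := by
      have ha := norm_le_osc hw0 (w * x + θ₀) (v x) (v' x)
      have hb := norm_deriv_le_osc hw0 (w * x + θ₀) (v x) (v' x)
      rw [abs_of_pos hw] at hb
      rw [hα_def, hβ_def]; dsimp only
      linarith
    calc ‖β' x‖ ≤ 1 / w * (c x * (‖v x‖ + ‖v' x‖)) := h1
      _ ≤ 1 / w * (c x * ((1 + w) * (‖α x‖ + ‖β x‖))) := by
          gcongr
          · exact hc0 x hx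
      _ = ct x * (‖α x‖ + ‖β x‖) := by rw [hct]; ring
  -- a point `x₁` beyond which `‖α‖ ≤ 1` and the tail of `∫ c̃` is `≤ 1/2`
  have hctint : IntegrableOn ct (Ioi x₀) := hcint.mul_const _
  set I : ℝ := ∫ t in Ioi x₀, ct t with hI
  have hT : Tendsto (fun X => ∫ t in x₀..X, ct t) atTop (𝓝 I) :=
    intervalIntegral_tendsto_integral_Ioi x₀ hctint tendsto_id
  have htail : ∀ X, x₀ ≤ X → ∫ t in Ioi X, ct t = I - ∫ t in x₀..X, ct t := by
    intro X hX
    rw [hI, intervalIntegral.integral_of_le hX, ← Ioc_union_Ioi_eq_Ioi hX,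
      setIntegral_union (Set.disjoint_left.2 fun t (ht : t ∈ Ioc x₀ X) (ht' : t ∈ Ioi X) =>
          (not_lt.2 ht.2) ht') measurableSet_Ioi
        (hctint.mono_set Ioc_subset_Ioi_self) (hctint.mono_set (Ioi_subset_Ioi hX))]
    ring
  have htail0 : Tendsto (fun X => ∫ t in Ioi X, ct t) atTop (𝓝 0) := by
    have h := (tendsto_const_nhds (x := I)).sub hT
    rw [sub_self] at h
    refine h.congr' ?_
    filter_upwards [eventually_ge_atTop x₀] with X hX
    exact (htail X hX).symm
  obtain ⟨N₁, hN₁⟩ : ∃ N, ∀ x ≥ N, ‖α x‖ ≤ 1 := by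
    have h : ∀ᶠ x in atTop, ‖α x‖ ≤ 1 := by
      have := (tendsto_norm_zero.comp hα)
      exact (this.eventually (ge_mem_nhds zero_lt_one))
    exact eventually_atTop.1 h
  obtain ⟨N₂, hN₂⟩ : ∃ N, ∀ X ≥ N, ∫ t in Ioi X, ct t ≤ 1 / 2 :=
    eventually_atTop.1 (htail0.eventually (ge_mem_nhds (by norm_num : (0:ℝ) < 1 / 2)))
  set x₁ : ℝ := max (max N₁ N₂) (x₀ + 1) with hx₁
  have hx₁₀ : x₀ < x₁ := lt_of_lt_of_le (lt_add_one x₀) (le_max_right _ _)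
  have hx₁N₁ : N₁ ≤ x₁ := (le_max_left _ _).trans (le_max_left _ _)
  have hx₁N₂ : N₂ ≤ x₁ := (le_max_right _ _).trans (le_max_left _ _)
  have hsub₁ : Ioi x₁ ⊆ Ioi x₀ := Ioi_subset_Ioi hx₁₀.le
  have htail₁ : ∫ t in Ioi x₁, ct t ≤ 1 / 2 := hN₂ x₁ hx₁N₂
  -- integrals of `ct` over subintervals of `[x₁, ∞)` are `≤ 1/2`
  have hct_sub : ∀ x y, x₁ ≤ x → x ≤ y → ∫ t in x..y, ct t ≤ 1 / 2 := by
    intro x y hx hxy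
    rw [intervalIntegral.integral_of_le hxy]
    refine le_trans ?_ htail₁
    refine setIntegral_mono_set (hctint.mono_set hsub₁) ?_ (ae_of_all _ fun t ht => ?_)
    · rw [EventuallyLE, ae_restrict_iff' measurableSet_Ioi]
      exact ae_of_all _ fun t ht => hct0 t (hsub₁ ht)
    · exact lt_of_lt_of_le (lt_of_le_of_lt hx ht.1) le_rfl
  -- FTC for β on [x₁, x]
  have hβFTC : ∀ x, x₁ ≤ x → β x - β x₁ = ∫ t in x₁..x, β' t := by
    intro x hx
    have hsub : uIcc x₁ x ⊆ Ioi x₀ := by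
      rw [uIcc_of_le hx]; exact fun t ht => lt_of_lt_of_le hx₁₀ ht.1
    exact (integral_eq_sub_of_hasDerivAt (fun t ht => hβd t (hsub ht))
      ((hβ'c.mono hsub).intervalIntegrable)).symm
  -- uniform bound on β beyond x₁
  set S₀ : ℝ := 2 * ‖β x₁‖ + 1 with hS₀
  have hβbound : ∀ x, x₁ ≤ x → ‖β x‖ ≤ S₀ := by
    intro X hX
    obtain ⟨xs, hxs, hmax⟩ := (isCompact_Icc (a := x₁) (b := X)).exists_isMaxOn
      (nonempty_Icc.2 hX) ((hβc.mono fun t ht => lt_of_lt_of_le hx₁₀ ht.1).norm)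
    set S : ℝ := ‖β xs‖ with hS
    have hSle : ∀ x ∈ Icc x₁ X, ‖β x‖ ≤ S := fun x hx => hmax hx
    have hS0 : 0 ≤ S := norm_nonneg _
    -- bound at the maximiser
    have hkey : ∀ x ∈ Icc x₁ X, ‖β x‖ ≤ ‖β x₁‖ + (1 + S) * (1 / 2) := by
      intro x hx
      have h1 : ‖β x - β x₁‖ ≤ ∫ t in x₁..x, ct t * (1 + S) := by
        rw [hβFTC x hx.1]
        refine intervalIntegral.norm_integral_le_of_norm_le hx.1 (ae_of_all _ fun t ht => ?_) ?_
        · have ht₀ : t ∈ Ioi x₀ := lt_of_lt_of_le hx₁₀ ht.1.le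
          calc ‖β' t‖ ≤ ct t * (‖α t‖ + ‖β t‖) := hβ'le t ht₀
            _ ≤ ct t * (1 + S) := by
              refine mul_le_mul_of_nonneg_left (add_le_add (hN₁ t (hx₁N₁.trans ht.1.le))
                (hSle t ⟨ht.1.le, ht.2.trans hx.2⟩)) (hct0 t ht₀)
        · have hsub : uIcc x₁ x ⊆ Ioi x₀ := by
            rw [uIcc_of_le hx.1]; exact fun t ht => lt_of_lt_of_le hx₁₀ ht.1
          exact ((hctc.mono hsub).mul continuousOn_const).intervalIntegrable
      have h2 : ∫ t in x₁..x, ct t * (1 + S) ≤ 1 / 2 * (1 + S) := by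
        rw [intervalIntegral.integral_mul_const]
        exact mul_le_mul_of_nonneg_right (hct_sub x₁ x le_rfl hx.1) (by positivity)
      calc ‖β x‖ = ‖β x₁ + (β x - β x₁)‖ := by ring_nf
        _ ≤ ‖β x₁‖ + ‖β x - β x₁‖ := norm_add_le _ _
        _ ≤ ‖β x₁‖ + (1 + S) * (1 / 2) := by linarith
    have hSbound : S ≤ S₀ := by
      have := hkey xs hxs
      rw [← hS] at this
      rw [hS₀]; linarith
    exact (hSle X (right_mem_Icc.2 hX)).trans hSbound
  -- β′ is integrable on (x₁, ∞)
  have hβ'int : IntegrableOn β' (Ioi x₁) := by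
    refine Integrable.mono' (((hctint.mono_set hsub₁).mul_const (1 + S₀)))
      (hβ'c.mono hsub₁ |>.aestronglyMeasurable measurableSet_Ioi) ?_
    rw [ae_restrict_iff' measurableSet_Ioi]
    refine ae_of_all _ fun t ht => ?_
    have ht₀ : t ∈ Ioi x₀ := hsub₁ ht
    calc ‖β' t‖ ≤ ct t * (‖α t‖ + ‖β t‖) := hβ'le t ht₀
      _ ≤ ct t * (1 + S₀) := mul_le_mul_of_nonneg_left
          (add_le_add (hN₁ t (hx₁N₁.trans (le_of_lt ht))) (hβbound t (le_of_lt ht))) (hct0 t ht₀)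
  -- conclusion
  refine ⟨β x₁ + ∫ t in Ioi x₁, β' t, ?_⟩
  have hlim : Tendsto (fun X => β x₁ + ∫ t in x₁..X, β' t) atTop (𝓝 (β x₁ + ∫ t in Ioi x₁, β' t)) :=
    tendsto_const_nhds.add (intervalIntegral_tendsto_integral_Ioi x₁ hβ'int tendsto_id)
  refine hlim.congr' ?_
  filter_upwards [eventually_ge_atTop x₁] with X hX
  have := hβFTC X hX
  rw [← this]; ring

end Osculating

/-! ## The prolate equation at `+∞`: `v = x g` satisfies `v″ + ω²v = O(x⁻²)(v, v′)` -/

section Prolate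

open Literature.NumberTheory.ConnesConsani2024

variable {lam : ℝ}

/-- `S = ℝ ∖ {±λ}` is open (plumbing). [folklore] -/
private theorem isOpen_ne_ne'' (lam : ℝ) : IsOpen {x : ℝ | x ≠ lam ∧ x ≠ -lam} :=
  isOpen_ne.and isOpen_ne

/-- The second-order identity behind Cor 1.7 (ii): for `g` smooth off `±λ` with `(p g′)′ = (q − μ) g`
(`p = λ² − x²`, `q = (2πλx)²`), the function `v = x g` satisfies
`p (v″ + ω² v) = 2λ² g′ + (ω²λ² − μ) v`, `ω = 2πλ`. [cite: ConnesMoscovici2022, Cor 1.7 (ii) (= arXiv:2112.05500 Cor 2.7; proof p0007:L1–L4, "known bases of formal solutions … around ±∞")] -/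
theorem prolate_v_identity (lam μ : ℝ) {g : ℝ → ℂ}
    (hsm : ContDiffOn ℝ ∞ g {x | x ≠ lam ∧ x ≠ -lam})
    (hu : ∀ x ∈ {x : ℝ | x ≠ lam ∧ x ≠ -lam},
      HasDerivAt (fun y => pCoeff lam y * deriv g y) ((qCoeff lam x - μ) * g x) x)
    {x : ℝ} (hx : x ∈ {x : ℝ | x ≠ lam ∧ x ≠ -lam}) :
    pCoeff lam x * ((2 * deriv g x + x * deriv (deriv g) x) + ((2 * π * lam : ℝ) : ℂ) ^ 2 * (x * g x)) =
      2 * (lam : ℂ) ^ 2 * deriv g x + (((2 * π * lam) ^ 2 * lam ^ 2 - μ : ℝ) : ℂ) * (x * g x) := by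
  have hS := isOpen_ne_ne'' lam
  have hd1 : ContDiffOn ℝ 1 (deriv g) {x : ℝ | x ≠ lam ∧ x ≠ -lam} :=
    hsm.deriv_of_isOpen hS (by norm_cast)
  have hdg : HasDerivAt (deriv g) (deriv (deriv g) x) x :=
    ((hd1.differentiableOn one_ne_zero x hx).differentiableAt (hS.mem_nhds hx)).hasDerivAt
  have hp : HasDerivAt (fun y => pCoeff lam y) (((-(2 * x) : ℝ)) : ℂ) x := by
    unfold pCoeff
    have h := (((hasDerivAt_const x (lam ^ 2)).sub (hasDerivAt_pow 2 x))).ofReal_comp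
    refine h.congr_deriv ?_
    push_cast; ring
  have hprod := hp.fun_mul hdg
  have huniq := (hu x hx).unique hprod
  -- huniq : (q - μ) g = -2x g′ + p g″
  unfold qCoeff at huniq
  unfold pCoeff at huniq ⊢
  push_cast at huniq ⊢
  linear_combination (-(x : ℂ)) * huniq

/-- The forcing bound at `+∞`: for `x > max(2λ, 1)`,
`‖v″ + ω²v‖ ≤ (K/x²)(‖v‖ + ‖v′‖)` with `K = (4/3)(2λ² + ω²λ² + |μ|)`, where `v = x g`, `v′ = g + x g′`,
`v″ = 2g′ + x g″`. [cite: ConnesMoscovici2022, Cor 1.7 (ii) (= arXiv:2112.05500 Cor 2.7; proof p0007:L1–L4)] -/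
theorem prolate_v_forcing_bound (lam μ : ℝ) (hlam : 0 < lam) {g : ℝ → ℂ}
    (hsm : ContDiffOn ℝ ∞ g {x | x ≠ lam ∧ x ≠ -lam})
    (hu : ∀ x ∈ {x : ℝ | x ≠ lam ∧ x ≠ -lam},
      HasDerivAt (fun y => pCoeff lam y * deriv g y) ((qCoeff lam x - μ) * g x) x)
    {x : ℝ} (hx : max (2 * lam) 1 < x) :
    ‖(2 * deriv g x + x * deriv (deriv g) x) + ((2 * π * lam : ℝ) : ℂ) ^ 2 * (x * g x)‖ ≤
      (4 / 3 * (2 * lam ^ 2 + (2 * π * lam) ^ 2 * lam ^ 2 + |μ|)) / x ^ 2 *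
        (‖(x : ℂ) * g x‖ + ‖g x + x * deriv g x‖) := by
  have h2l : 2 * lam < x := lt_of_le_of_lt (le_max_left _ _) hx
  have h1 : 1 < x := lt_of_le_of_lt (le_max_right _ _) hx
  have hx0 : 0 < x := by linarith
  have hxS : x ∈ {x : ℝ | x ≠ lam ∧ x ≠ -lam} := ⟨by intro h; linarith, by intro h; linarith⟩
  have hid := prolate_v_identity lam μ hsm hu hxS
  set V : ℂ := (x : ℂ) * g x with hV
  set V' : ℂ := g x + x * deriv g x with hV'
  set F : ℂ := (2 * deriv g x + x * deriv (deriv g) x) + ((2 * π * lam : ℝ) : ℂ) ^ 2 * (x * g x) with hF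
  have hp : ‖pCoeff lam x‖ = x ^ 2 - lam ^ 2 := by
    rw [pCoeff, Complex.norm_real, Real.norm_eq_abs, abs_of_nonpos (by nlinarith), neg_sub]
  have hp34 : 3 / 4 * x ^ 2 ≤ x ^ 2 - lam ^ 2 := by nlinarith
  have hppos : 0 < x ^ 2 - lam ^ 2 := by nlinarith
  -- g′ in terms of V, V′:  x g′ = V′ − g,  g = V/x
  have hg_eq : g x = V / x := by
    rw [hV, mul_comm, mul_div_assoc, div_self (Complex.ofReal_ne_zero.2 hx0.ne'), mul_one]
  have hg'_eq : deriv g x = (V' - g x) / x := by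
    rw [hV', eq_div_iff (Complex.ofReal_ne_zero.2 hx0.ne')]; ring
  have hng : ‖g x‖ ≤ ‖V‖ := by
    rw [hg_eq, norm_div, Complex.norm_real, Real.norm_eq_abs, abs_of_pos hx0]
    exact div_le_self (norm_nonneg _) h1.le
  have hng' : ‖deriv g x‖ ≤ ‖V‖ + ‖V'‖ := by
    rw [hg'_eq, norm_div, Complex.norm_real, Real.norm_eq_abs, abs_of_pos hx0]
    calc ‖V' - g x‖ / x ≤ ‖V' - g x‖ := div_le_self (norm_nonneg _) h1.le
      _ ≤ ‖V'‖ + ‖g x‖ := norm_sub_le _ _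
      _ ≤ ‖V‖ + ‖V'‖ := by linarith
  -- ‖p F‖ = ‖2λ² g′ + (ω²λ² − μ) V‖ ≤ K₀ (‖V‖ + ‖V′‖)
  set K₀ : ℝ := 2 * lam ^ 2 + (2 * π * lam) ^ 2 * lam ^ 2 + |μ| with hK₀
  have hnum : ‖pCoeff lam x * F‖ ≤ K₀ * (‖V‖ + ‖V'‖) := by
    rw [hF, hid]
    calc ‖2 * (lam : ℂ) ^ 2 * deriv g x + (((2 * π * lam) ^ 2 * lam ^ 2 - μ : ℝ) : ℂ) * (x * g x)‖
        ≤ ‖2 * (lam : ℂ) ^ 2 * deriv g x‖ + ‖(((2 * π * lam) ^ 2 * lam ^ 2 - μ : ℝ) : ℂ) * (x * g x)‖ :=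
          norm_add_le _ _
      _ = 2 * lam ^ 2 * ‖deriv g x‖ + |(2 * π * lam) ^ 2 * lam ^ 2 - μ| * ‖V‖ := by
          have ha : ‖2 * (lam : ℂ) ^ 2 * deriv g x‖ = 2 * lam ^ 2 * ‖deriv g x‖ := by
            rw [norm_mul, norm_mul, norm_pow, Complex.norm_real, Real.norm_eq_abs, abs_of_pos hlam,
              Complex.norm_two]
          have hb : ‖(((2 * π * lam) ^ 2 * lam ^ 2 - μ : ℝ) : ℂ) * (x * g x)‖ =
              |(2 * π * lam) ^ 2 * lam ^ 2 - μ| * ‖V‖ := by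
            rw [norm_mul, Complex.norm_real, Real.norm_eq_abs, hV]
          rw [ha, hb]
      _ ≤ 2 * lam ^ 2 * (‖V‖ + ‖V'‖) + ((2 * π * lam) ^ 2 * lam ^ 2 + |μ|) * ‖V‖ := by
          gcongr
          exact (abs_sub _ _).trans (by rw [abs_of_nonneg (by positivity)])
      _ ≤ K₀ * (‖V‖ + ‖V'‖) := by
          rw [hK₀]
          nlinarith [mul_nonneg (by positivity : (0:ℝ) ≤ (2 * π * lam) ^ 2 * lam ^ 2 + |μ|)
            (norm_nonneg V')]
  have hFle : ‖F‖ ≤ K₀ * (‖V‖ + ‖V'‖) / (x ^ 2 - lam ^ 2) := by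
    rw [le_div_iff₀ hppos, ← hp, mul_comm, ← norm_mul]
    exact hnum
  calc ‖F‖ ≤ K₀ * (‖V‖ + ‖V'‖) / (x ^ 2 - lam ^ 2) := hFle
    _ ≤ K₀ * (‖V‖ + ‖V'‖) / (3 / 4 * x ^ 2) :=
        div_le_div_of_nonneg_left (by positivity) (by positivity) hp34
    _ = (4 / 3 * K₀) / x ^ 2 * (‖V‖ + ‖V'‖) := by
        field_simp

end Prolate

/-! ## From the osculating constants to the `o(1/x)` asymptotics, and the assembly -/

section Assembly

open Literature.NumberTheory.ConnesConsani2024 Asymptotics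

/-- If `α_θ → 0` and `β_θ → A` for `v = x g`, then `g(x) − A sin(ωx + θ₀)/x = o(1/x)`. [folklore] -/
private theorem isLittleO_of_osc {w θ₀ x₀ : ℝ} (hw : w ≠ 0) (hx₀ : 0 < x₀) {g v v' : ℝ → ℂ}
    (hvg : ∀ x ∈ Ioi x₀, v x = (x : ℂ) * g x) {A : ℂ}
    (hα : Tendsto (fun x => (Real.cos (w * x + θ₀) : ℂ) * v x - (Real.sin (w * x + θ₀) : ℂ) * v' x / w)
      atTop (𝓝 0))
    (hβ : Tendsto (fun x => (Real.sin (w * x + θ₀) : ℂ) * v x + (Real.cos (w * x + θ₀) : ℂ) * v' x / w)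
      atTop (𝓝 A)) :
    (fun x => g x - A * ((Real.sin (w * x + θ₀) / x : ℝ) : ℂ)) =o[atTop] fun x => (x⁻¹ : ℝ) := by
  rw [isLittleO_iff]
  intro ε hε
  have h1 : ∀ᶠ x in atTop, ‖(Real.cos (w * x + θ₀) : ℂ) * v x - (Real.sin (w * x + θ₀) : ℂ) * v' x / w‖
      < ε / 2 := (tendsto_norm_zero.comp hα).eventually (gt_mem_nhds (by positivity))
  have h2 : ∀ᶠ x in atTop, ‖(Real.sin (w * x + θ₀) : ℂ) * v x + (Real.cos (w * x + θ₀) : ℂ) * v' x / w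
      - A‖ < ε / 2 := by
    have h0 : Tendsto (fun x => (Real.sin (w * x + θ₀) : ℂ) * v x + (Real.cos (w * x + θ₀) : ℂ) * v' x / w
        - A) atTop (𝓝 0) := by
      have := hβ.sub_const A
      rwa [sub_self] at this
    exact (tendsto_norm_zero.comp h0).eventually (gt_mem_nhds (by positivity))
  filter_upwards [h1, h2, eventually_gt_atTop x₀] with x hαx hβx hx
  have hx0 : 0 < x := hx₀.trans hx
  have hxC : (x : ℂ) ≠ 0 := Complex.ofReal_ne_zero.2 hx0.ne'
  set θ : ℝ := w * x + θ₀
  set α : ℂ := (Real.cos θ : ℂ) * v x - (Real.sin θ : ℂ) * v' x / w with hαd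
  set β : ℂ := (Real.sin θ : ℂ) * v x + (Real.cos θ : ℂ) * v' x / w with hβd
  have hrec : (Real.cos θ : ℂ) * α + (Real.sin θ : ℂ) * β = v x := osc_reconstruct hw θ (v x) (v' x)
  have hident : g x - A * ((Real.sin θ / x : ℝ) : ℂ) =
      ((Real.cos θ : ℂ) * α + (Real.sin θ : ℂ) * (β - A)) / x := by
    rw [eq_div_iff hxC]
    have hre : (Real.cos θ : ℂ) * α + (Real.sin θ : ℂ) * (β - A) = v x - A * (Real.sin θ : ℂ) := by
      rw [← hrec]; ring
    rw [hre, hvg x hx]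
    push_cast
    field_simp
  rw [hident, norm_div, Complex.norm_real, Real.norm_eq_abs, abs_of_pos hx0, Real.norm_eq_abs,
    abs_of_pos (inv_pos.2 hx0), div_eq_mul_inv]
  refine mul_le_mul_of_nonneg_right ?_ (inv_pos.2 hx0).le
  calc ‖(Real.cos θ : ℂ) * α + (Real.sin θ : ℂ) * (β - A)‖
      ≤ ‖(Real.cos θ : ℂ) * α‖ + ‖(Real.sin θ : ℂ) * (β - A)‖ := norm_add_le _ _
    _ ≤ ‖α‖ + ‖β - A‖ := by
        rw [norm_mul, norm_mul, Complex.norm_real, Complex.norm_real, Real.norm_eq_abs, Real.norm_eq_abs]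
        exact add_le_add (mul_le_of_le_one_left (norm_nonneg _) (Real.abs_cos_le_one _))
          (mul_le_of_le_one_left (norm_nonneg _) (Real.abs_sin_le_one _))
    _ ≤ ε := by linarith

variable {lam : ℝ}

/-- **Core of Cor 1.7 (ii).**  For `g` smooth off `±λ` solving `(p g′)′ = (q − μ) g`, with `v = x g`:
if the osculating constant `α_θ = cos(ωx+θ₀) v − sin(ωx+θ₀) v′/ω` tends to `0` at `+∞`
(`ω = 2πλ`), then `g(x) = A sin(ωx + θ₀)/x + o(1/x)` for some `A`.
[cite: ConnesMoscovici2022, Cor 1.7 (ii) (= arXiv:2112.05500 Cor 2.7, chunk p0006:L116–L123; proof p0007:L1–L4)] -/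
theorem exists_isLittleO_of_osc_tendsto_zero (hlam : 0 < lam) (μ θ₀ : ℝ) {g : ℝ → ℂ}
    (hsm : ContDiffOn ℝ ∞ g {x | x ≠ lam ∧ x ≠ -lam})
    (hu : ∀ x ∈ {x : ℝ | x ≠ lam ∧ x ≠ -lam},
      HasDerivAt (fun y => pCoeff lam y * deriv g y) ((qCoeff lam x - μ) * g x) x)
    (hα : Tendsto (fun x : ℝ => (Real.cos (2 * π * lam * x + θ₀) : ℂ) * (x * g x) -
        (Real.sin (2 * π * lam * x + θ₀) : ℂ) * (g x + x * deriv g x) / (2 * π * lam)) atTop (𝓝 0)) :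
    ∃ A : ℂ, (fun x => g x - A * ((Real.sin (2 * π * lam * x + θ₀) / x : ℝ) : ℂ)) =o[atTop]
      fun x => (x⁻¹ : ℝ) := by
  have hS := isOpen_ne_ne'' lam
  set w : ℝ := 2 * π * lam with hw_def
  have hw : 0 < w := by positivity
  set x₀ : ℝ := max (2 * lam) 1 with hx₀
  have hx₀pos : 0 < x₀ := lt_of_lt_of_le one_pos (le_max_right _ _)
  have hsub : Ioi x₀ ⊆ {x : ℝ | x ≠ lam ∧ x ≠ -lam} := fun x hx => by
    have h2l : 2 * lam < x := lt_of_le_of_lt (le_max_left _ _) hx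
    exact ⟨by intro h; rw [h] at h2l; linarith, by intro h; rw [h] at h2l; linarith⟩
  -- v, v', v''
  set v : ℝ → ℂ := fun x => (x : ℂ) * g x with hv_def
  set v' : ℝ → ℂ := fun x => g x + x * deriv g x with hv'_def
  set v'' : ℝ → ℂ := fun x => 2 * deriv g x + x * deriv (deriv g) x with hv''_def
  have hd1 : ContDiffOn ℝ 1 (deriv g) {x : ℝ | x ≠ lam ∧ x ≠ -lam} :=
    hsm.deriv_of_isOpen hS (by norm_cast)
  have hd2 : ContDiffOn ℝ 0 (deriv (deriv g)) {x : ℝ | x ≠ lam ∧ x ≠ -lam} :=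
    hd1.deriv_of_isOpen hS (by norm_cast)
  have hgd : ∀ x ∈ {x : ℝ | x ≠ lam ∧ x ≠ -lam}, HasDerivAt g (deriv g x) x := fun x hx =>
    ((hsm.differentiableOn (by simp) x hx).differentiableAt (hS.mem_nhds hx)).hasDerivAt
  have hdgd : ∀ x ∈ {x : ℝ | x ≠ lam ∧ x ≠ -lam}, HasDerivAt (deriv g) (deriv (deriv g) x) x :=
    fun x hx => ((hd1.differentiableOn one_ne_zero x hx).differentiableAt (hS.mem_nhds hx)).hasDerivAt
  have hid : ∀ x : ℝ, HasDerivAt (fun y : ℝ => (y : ℂ)) 1 x := fun x => by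
    simpa using (hasDerivAt_id x).ofReal_comp
  have hv : ∀ x ∈ Ioi x₀, HasDerivAt v (v' x) x := by
    intro x hx
    refine ((hid x).fun_mul (hgd x (hsub hx))).congr_deriv ?_
    rw [hv'_def]; dsimp only; ring
  have hv' : ∀ x ∈ Ioi x₀, HasDerivAt v' (v'' x) x := by
    intro x hx
    refine ((hgd x (hsub hx)).fun_add ((hid x).fun_mul (hdgd x (hsub hx)))).congr_deriv ?_
    rw [hv''_def]; dsimp only; ring
  have hv''c : ContinuousOn v'' (Ioi x₀) := by
    rw [hv''_def]
    exact (continuousOn_const.mul (hd1.continuousOn.mono hsub)).add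
      ((Complex.continuous_ofReal.continuousOn).mul (hd2.continuousOn.mono hsub))
  -- the forcing bound
  set K : ℝ := 4 / 3 * (2 * lam ^ 2 + (2 * π * lam) ^ 2 * lam ^ 2 + |μ|) with hK
  have hK0 : 0 ≤ K := by positivity
  set c : ℝ → ℝ := fun x => K / x ^ 2 with hc_def
  have hcc : ContinuousOn c (Ioi x₀) := by
    rw [hc_def]
    exact continuousOn_const.div (continuousOn_pow 2) fun x hx => (pow_pos (hx₀pos.trans hx) 2).ne'
  have hc0 : ∀ x ∈ Ioi x₀, 0 ≤ c x := fun x hx => by rw [hc_def]; positivity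
  have hcint : IntegrableOn c (Ioi x₀) := by
    have h : IntegrableOn (fun x : ℝ => K * x ^ (-2 : ℝ)) (Ioi x₀) :=
      (integrableOn_Ioi_rpow_of_lt (by norm_num : (-2 : ℝ) < -1) hx₀pos).const_mul K
    refine IntegrableOn.congr_fun h (fun x hx => ?_) measurableSet_Ioi
    have hx0 : 0 < x := hx₀pos.trans hx
    rw [hc_def]; dsimp only
    rw [Real.rpow_neg hx0.le, show (2 : ℝ) = ((2 : ℕ) : ℝ) by norm_num, Real.rpow_natCast,
      div_eq_mul_inv]
  have hF : ∀ x ∈ Ioi x₀, ‖v'' x + (w : ℂ) ^ 2 * v x‖ ≤ c x * (‖v x‖ + ‖v' x‖) := by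
    intro x hx
    have h := prolate_v_forcing_bound lam μ hlam hsm hu hx
    rw [hv''_def, hv_def, hv'_def, hc_def, hw_def]
    exact h
  -- the abstract lemma
  have hα' : Tendsto (fun x => (Real.cos (w * x + θ₀) : ℂ) * v x - (Real.sin (w * x + θ₀) : ℂ) * v' x / w)
      atTop (𝓝 0) := by
    simpa only [hw_def, hv_def, hv'_def, Complex.ofReal_mul, Complex.ofReal_ofNat] using hα
  obtain ⟨A, hA⟩ := exists_tendsto_osc_of_tendsto_osc_zero (θ₀ := θ₀) hw hv hv' hv''c hcc hc0 hcint
    hF hα'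
  refine ⟨A, ?_⟩
  have h := isLittleO_of_osc (θ₀ := θ₀) hw.ne' hx₀pos (g := g) (fun x _ => rfl) hα' hA
  rw [hw_def] at h
  exact h

/-- The boundary expression (1.20) in terms of the osculating constant at phase `0`:
`bcInfEven λ g = −ω α₀`, `v = x g`. [cite: ConnesMoscovici2022, §1 boundary condition (1.20) (= arXiv (2.20), chunk p0006:L64–L66)] -/
theorem bcInfEven_eq_osc (lam : ℝ) (hlam : 0 < lam) (g : ℝ → ℂ) (x : ℝ) :
    bcInfEven lam g x = -((2 * π * lam : ℝ) : ℂ) *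
      ((Real.cos (2 * π * lam * x + 0) : ℂ) * (x * g x) -
        (Real.sin (2 * π * lam * x + 0) : ℂ) * (g x + x * deriv g x) / (2 * π * lam)) := by
  have hl : (lam : ℂ) ≠ 0 := Complex.ofReal_ne_zero.2 hlam.ne'
  have hπ : ((π : ℝ) : ℂ) ≠ 0 := Complex.ofReal_ne_zero.2 Real.pi_pos.ne'
  rw [bcInfEven, add_zero]
  push_cast
  field_simp
  ring

/-- The boundary expression (1.21) in terms of the osculating constant at phase `π/2`:
`bcInfOdd λ g = −ω α_{π/2}`. [cite: ConnesMoscovici2022, §1 boundary condition (1.21) (= arXiv (2.21), chunk p0006:L67–L69)] -/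
theorem bcInfOdd_eq_osc (lam : ℝ) (hlam : 0 < lam) (g : ℝ → ℂ) (x : ℝ) :
    bcInfOdd lam g x = -((2 * π * lam : ℝ) : ℂ) *
      ((Real.cos (2 * π * lam * x + π / 2) : ℂ) * (x * g x) -
        (Real.sin (2 * π * lam * x + π / 2) : ℂ) * (g x + x * deriv g x) / (2 * π * lam)) := by
  have hl : (lam : ℂ) ≠ 0 := Complex.ofReal_ne_zero.2 hlam.ne'
  have hπ : ((π : ℝ) : ℂ) ≠ 0 := Complex.ofReal_ne_zero.2 Real.pi_pos.ne'
  rw [bcInfOdd, Real.cos_add_pi_div_two, Real.sin_add_pi_div_two]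
  push_cast
  field_simp
  ring

/-- An a.e. parity relation for a function continuous off `±λ` holds everywhere off `±λ`.
[folklore] -/
private theorem parity_of_ae {lam : ℝ} {g : ℝ → ℂ} (hgc : ContinuousOn g {x | x ≠ lam ∧ x ≠ -lam})
    {s : ℂ} (hae : ∀ᵐ x : ℝ, g (-x) = s * g x) :
    EqOn (fun x => g (-x)) (fun x => s * g x) {x | x ≠ lam ∧ x ≠ -lam} := by
  have hS := isOpen_ne_ne'' lam
  refine Measure.eqOn_open_of_ae_eq (ae_restrict_of_ae hae) hS ?_ (continuousOn_const.mul hgc)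
  refine hgc.comp continuous_neg.continuousOn fun x hx => ?_
  simp only [mem_setOf_eq] at hx ⊢
  exact ⟨fun h => hx.2 (by linarith), fun h => hx.1 (by linarith)⟩

/-- **Connes–Moscovici 2022, Corollary 1.7** — discharge of the named fact `CM22_cor_1_7` (both
clauses, as typed): (i) from `UVProlateEigenfunctionEndpoint.lean`; (ii) for an eigenfunction whose
representative is a.e. even (resp. odd), `g(x) − c sin(2πλx)/x = o(1/x)` (resp. `cos`) at `+∞`, by
the osculating-constants lemma: the boundary condition (1.20) (resp. (1.21)) says exactly that
`α₀ → 0` (resp. `α_{π/2} → 0`).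
[cite: ConnesMoscovici2022, Cor 1.7 (= arXiv:2112.05500 Cor 2.7, chunk p0006:L116–L123; proof p0007:L1–L4)] -/
theorem CM22_cor_1_7_holds : CM22_cor_1_7 := by
  intro lam hlam W hSA μ φ hev
  obtain ⟨g, hfg, hclause, hbc, hsm⟩ := CM22_cor_1_7_i lam hlam W hSA μ φ hev
  obtain ⟨hφ, hW, -⟩ := exists_repr_of_hasEigenvector hSA hev
  have hS := isOpen_ne_ne'' lam
  have hu : ∀ x ∈ {x : ℝ | x ≠ lam ∧ x ≠ -lam},
      HasDerivAt (fun y => pCoeff lam y * deriv g y) ((qCoeff lam x - μ) * g x) x :=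
    fun x hx => hasDerivAt_pCoeff_mul_deriv_repr hlam hφ hW hfg hbc.differentiableOn hx.1 hx.2
  have hIoi : Ioi lam ⊆ {x : ℝ | x ≠ lam ∧ x ≠ -lam} := fun x hx =>
    ⟨ne_of_gt hx, by intro h; rw [h] at hx; exact absurd hx (by simp; linarith)⟩
  -- parity transfer: if g(−x) = s g(x) a.e. then `evenFn g` / `oddFn g` agree with g off ±λ
  have hkey : ∀ (s : ℂ) (P : (ℝ → ℂ) → ℝ → ℂ), (P = evenFn ∧ s = 1 ∨ P = oddFn ∧ s = -1) →
      (∀ᵐ x : ℝ, g (-x) = s * g x) → ∀ x ∈ Ioi lam, P g =ᶠ[𝓝 x] g := by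
    rintro s P hP hae x hx
    have hpar := parity_of_ae hsm.continuousOn hae
    filter_upwards [hS.mem_nhds (hIoi hx)] with y hy
    have hy' := hpar hy
    simp only at hy'
    rcases hP with ⟨rfl, rfl⟩ | ⟨rfl, rfl⟩
    · rw [evenFn, hy']; ring
    · rw [oddFn, hy']; ring
  have htransfer : ∀ (s : ℂ) (P : (ℝ → ℂ) → ℝ → ℂ) (B : ℝ → (ℝ → ℂ) → ℝ → ℂ),
      (P = evenFn ∧ s = 1 ∨ P = oddFn ∧ s = -1) → (B = bcInfEven ∨ B = bcInfOdd) →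
      (∀ᵐ x : ℝ, g (-x) = s * g x) → Tendsto (B lam (P g)) atTop (𝓝 0) →
      Tendsto (B lam g) atTop (𝓝 0) := by
    intro s P B hP hB hae hT
    refine hT.congr' ?_
    filter_upwards [eventually_gt_atTop lam] with x hx
    have h1 : P g =ᶠ[𝓝 x] g := hkey s P hP hae x hx
    have h2 : P g x = g x := h1.eq_of_nhds
    have h3 : deriv (P g) x = deriv g x := h1.deriv_eq
    rcases hB with rfl | rfl
    · rw [bcInfEven, bcInfEven, h2, h3]
    · rw [bcInfOdd, bcInfOdd, h2, h3]
  refine ⟨g, hfg, hclause, fun heven => ?_, fun hodd => ?_⟩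
  · -- even case: BC (1.20) ⇒ α₀ → 0
    have hae : ∀ᵐ x : ℝ, g (-x) = (1 : ℂ) * g x := by
      filter_upwards [heven] with x hx; rw [one_mul]; exact hx
    have hT : Tendsto (bcInfEven lam g) atTop (𝓝 0) :=
      htransfer 1 evenFn bcInfEven (Or.inl ⟨rfl, rfl⟩) (Or.inl rfl) hae hbc.evenTop
    have hα : Tendsto (fun x : ℝ => (Real.cos (2 * π * lam * x + 0) : ℂ) * (x * g x) -
        (Real.sin (2 * π * lam * x + 0) : ℂ) * (g x + x * deriv g x) / (2 * π * lam)) atTop (𝓝 0) := by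
      have hw : ((2 * π * lam : ℝ) : ℂ) ≠ 0 := Complex.ofReal_ne_zero.2 (by positivity)
      have h := hT.const_mul (-((2 * π * lam : ℝ) : ℂ))⁻¹
      rw [mul_zero] at h
      refine h.congr fun x => ?_
      rw [bcInfEven_eq_osc lam hlam g x, ← mul_assoc, inv_mul_cancel₀ (neg_ne_zero.2 hw), one_mul]
    obtain ⟨A, hA⟩ := exists_isLittleO_of_osc_tendsto_zero hlam μ 0 hsm hu hα
    refine ⟨A, ?_⟩
    simpa only [add_zero] using hA
  · -- odd case: BC (1.21) ⇒ α_{π/2} → 0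
    have hae : ∀ᵐ x : ℝ, g (-x) = (-1 : ℂ) * g x := by
      filter_upwards [hodd] with x hx; rw [neg_one_mul]; exact hx
    have hT : Tendsto (bcInfOdd lam g) atTop (𝓝 0) :=
      htransfer (-1) oddFn bcInfOdd (Or.inr ⟨rfl, rfl⟩) (Or.inr rfl) hae hbc.oddTop
    have hα : Tendsto (fun x : ℝ => (Real.cos (2 * π * lam * x + π / 2) : ℂ) * (x * g x) -
        (Real.sin (2 * π * lam * x + π / 2) : ℂ) * (g x + x * deriv g x) / (2 * π * lam))
        atTop (𝓝 0) := by
      have hw : ((2 * π * lam : ℝ) : ℂ) ≠ 0 := Complex.ofReal_ne_zero.2 (by positivity)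
      have h := hT.const_mul (-((2 * π * lam : ℝ) : ℂ))⁻¹
      rw [mul_zero] at h
      refine h.congr fun x => ?_
      rw [bcInfOdd_eq_osc lam hlam g x, ← mul_assoc, inv_mul_cancel₀ (neg_ne_zero.2 hw), one_mul]
    obtain ⟨A, hA⟩ := exists_isLittleO_of_osc_tendsto_zero hlam μ (π / 2) hsm hu hα
    refine ⟨A, ?_⟩
    simpa only [Real.sin_add_pi_div_two] using hA

end Assembly

/-! ## Strong form of the asymptotics: `x g(x) − A sin(ωx+θ₀) → 0` together with the derivative
`g + x g′ − ωA cos(ωx+θ₀) → 0` (exported for the Green's-formula arguments at `+∞` of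
[ConnesMoscovici2022, §2], e.g. Cor 2.2) -/

section Strong

open Literature.NumberTheory.ConnesConsani2024 Asymptotics

variable {lam : ℝ}

/-- **Strong asymptotics.**  Under the hypotheses of `exists_isLittleO_of_osc_tendsto_zero`
(`g` smooth off `±λ`, `(p g′)′ = (q − μ) g`, osculating constant `α_θ → 0` at `+∞`), with `v = x g`,
`v′ = g + x g′`, `ω = 2πλ`: for some `A`, `v(x) − A sin(ωx + θ₀) → 0` AND `v′(x) − ωA cos(ωx + θ₀) → 0`.
[cite: ConnesMoscovici2022, Cor 1.7 (ii) (= arXiv:2112.05500 Cor 2.7, chunk p0006:L116–L123; proof p0007:L1–L4)] -/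
theorem exists_tendsto_v_sub_of_osc_tendsto_zero (hlam : 0 < lam) (μ θ₀ : ℝ) {g : ℝ → ℂ}
    (hsm : ContDiffOn ℝ ∞ g {x | x ≠ lam ∧ x ≠ -lam})
    (hu : ∀ x ∈ {x : ℝ | x ≠ lam ∧ x ≠ -lam},
      HasDerivAt (fun y => pCoeff lam y * deriv g y) ((qCoeff lam x - μ) * g x) x)
    (hα : Tendsto (fun x : ℝ => (Real.cos (2 * π * lam * x + θ₀) : ℂ) * (x * g x) -
        (Real.sin (2 * π * lam * x + θ₀) : ℂ) * (g x + x * deriv g x) / (2 * π * lam)) atTop (𝓝 0)) :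
    ∃ A : ℂ,
      Tendsto (fun x : ℝ => (x : ℂ) * g x - A * (Real.sin (2 * π * lam * x + θ₀) : ℂ)) atTop (𝓝 0) ∧
      Tendsto (fun x : ℝ => (g x + x * deriv g x) -
        ((2 * π * lam : ℝ) : ℂ) * A * (Real.cos (2 * π * lam * x + θ₀) : ℂ)) atTop (𝓝 0) := by
  have hS := isOpen_ne_ne'' lam
  set w : ℝ := 2 * π * lam with hw_def
  have hw : 0 < w := by positivity
  set x₀ : ℝ := max (2 * lam) 1 with hx₀
  have hx₀pos : 0 < x₀ := lt_of_lt_of_le one_pos (le_max_right _ _)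
  have hsub : Ioi x₀ ⊆ {x : ℝ | x ≠ lam ∧ x ≠ -lam} := fun x hx => by
    have h2l : 2 * lam < x := lt_of_le_of_lt (le_max_left _ _) hx
    exact ⟨by intro h; rw [h] at h2l; linarith, by intro h; rw [h] at h2l; linarith⟩
  set v : ℝ → ℂ := fun x => (x : ℂ) * g x with hv_def
  set v' : ℝ → ℂ := fun x => g x + x * deriv g x with hv'_def
  set v'' : ℝ → ℂ := fun x => 2 * deriv g x + x * deriv (deriv g) x with hv''_def
  have hd1 : ContDiffOn ℝ 1 (deriv g) {x : ℝ | x ≠ lam ∧ x ≠ -lam} :=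
    hsm.deriv_of_isOpen hS (by norm_cast)
  have hd2 : ContDiffOn ℝ 0 (deriv (deriv g)) {x : ℝ | x ≠ lam ∧ x ≠ -lam} :=
    hd1.deriv_of_isOpen hS (by norm_cast)
  have hgd : ∀ x ∈ {x : ℝ | x ≠ lam ∧ x ≠ -lam}, HasDerivAt g (deriv g x) x := fun x hx =>
    ((hsm.differentiableOn (by simp) x hx).differentiableAt (hS.mem_nhds hx)).hasDerivAt
  have hdgd : ∀ x ∈ {x : ℝ | x ≠ lam ∧ x ≠ -lam}, HasDerivAt (deriv g) (deriv (deriv g) x) x :=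
    fun x hx => ((hd1.differentiableOn one_ne_zero x hx).differentiableAt (hS.mem_nhds hx)).hasDerivAt
  have hid : ∀ x : ℝ, HasDerivAt (fun y : ℝ => (y : ℂ)) 1 x := fun x => by
    simpa using (hasDerivAt_id x).ofReal_comp
  have hv : ∀ x ∈ Ioi x₀, HasDerivAt v (v' x) x := by
    intro x hx
    refine ((hid x).fun_mul (hgd x (hsub hx))).congr_deriv ?_
    rw [hv'_def]; dsimp only; ring
  have hv' : ∀ x ∈ Ioi x₀, HasDerivAt v' (v'' x) x := by
    intro x hx
    refine ((hgd x (hsub hx)).fun_add ((hid x).fun_mul (hdgd x (hsub hx)))).congr_deriv ?_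
    rw [hv''_def]; dsimp only; ring
  have hv''c : ContinuousOn v'' (Ioi x₀) := by
    rw [hv''_def]
    exact (continuousOn_const.mul (hd1.continuousOn.mono hsub)).add
      ((Complex.continuous_ofReal.continuousOn).mul (hd2.continuousOn.mono hsub))
  set K : ℝ := 4 / 3 * (2 * lam ^ 2 + (2 * π * lam) ^ 2 * lam ^ 2 + |μ|) with hK
  have hK0 : 0 ≤ K := by positivity
  set c : ℝ → ℝ := fun x => K / x ^ 2 with hc_def
  have hcc : ContinuousOn c (Ioi x₀) := by
    rw [hc_def]
    exact continuousOn_const.div (continuousOn_pow 2) fun x hx => (pow_pos (hx₀pos.trans hx) 2).ne'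
  have hc0 : ∀ x ∈ Ioi x₀, 0 ≤ c x := fun x hx => by rw [hc_def]; positivity
  have hcint : IntegrableOn c (Ioi x₀) := by
    have h : IntegrableOn (fun x : ℝ => K * x ^ (-2 : ℝ)) (Ioi x₀) :=
      (integrableOn_Ioi_rpow_of_lt (by norm_num : (-2 : ℝ) < -1) hx₀pos).const_mul K
    refine IntegrableOn.congr_fun h (fun x hx => ?_) measurableSet_Ioi
    have hx0 : 0 < x := hx₀pos.trans hx
    rw [hc_def]; dsimp only
    rw [Real.rpow_neg hx0.le, show (2 : ℝ) = ((2 : ℕ) : ℝ) by norm_num, Real.rpow_natCast,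
      div_eq_mul_inv]
  have hF : ∀ x ∈ Ioi x₀, ‖v'' x + (w : ℂ) ^ 2 * v x‖ ≤ c x * (‖v x‖ + ‖v' x‖) := by
    intro x hx
    have h := prolate_v_forcing_bound lam μ hlam hsm hu hx
    rw [hv''_def, hv_def, hv'_def, hc_def, hw_def]
    exact h
  have hα' : Tendsto (fun x => (Real.cos (w * x + θ₀) : ℂ) * v x - (Real.sin (w * x + θ₀) : ℂ) * v' x / w)
      atTop (𝓝 0) := by
    simpa only [hw_def, hv_def, hv'_def, Complex.ofReal_mul, Complex.ofReal_ofNat] using hα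
  obtain ⟨A, hA⟩ := exists_tendsto_osc_of_tendsto_osc_zero (θ₀ := θ₀) hw hv hv' hv''c hcc hc0 hcint
    hF hα'
  refine ⟨A, ?_, ?_⟩
  · -- v − A sin θ = cos θ · α + sin θ · (β − A)
    have hβ0 : Tendsto (fun x => (Real.sin (w * x + θ₀) : ℂ) * v x + (Real.cos (w * x + θ₀) : ℂ) * v' x / w
        - A) atTop (𝓝 0) := by
      have := hA.sub_const A; rwa [sub_self] at this
    have hbd : ∀ x : ℝ, ‖(x : ℂ) * g x - A * (Real.sin (2 * π * lam * x + θ₀) : ℂ)‖ ≤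
        ‖(Real.cos (w * x + θ₀) : ℂ) * v x - (Real.sin (w * x + θ₀) : ℂ) * v' x / w‖ +
        ‖(Real.sin (w * x + θ₀) : ℂ) * v x + (Real.cos (w * x + θ₀) : ℂ) * v' x / w - A‖ := by
      intro x
      have hrec := osc_reconstruct hw.ne' (w * x + θ₀) (v x) (v' x)
      have hident : (x : ℂ) * g x - A * (Real.sin (2 * π * lam * x + θ₀) : ℂ) =
          (Real.cos (w * x + θ₀) : ℂ) *
            ((Real.cos (w * x + θ₀) : ℂ) * v x - (Real.sin (w * x + θ₀) : ℂ) * v' x / w) +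
          (Real.sin (w * x + θ₀) : ℂ) *
            ((Real.sin (w * x + θ₀) : ℂ) * v x + (Real.cos (w * x + θ₀) : ℂ) * v' x / w - A) := by
        have hvx : v x = (x : ℂ) * g x := rfl
        rw [hvx] at hrec
        rw [← hw_def]
        linear_combination (-1 : ℂ) * hrec
      rw [hident]
      refine (norm_add_le _ _).trans (add_le_add ?_ ?_) <;> rw [norm_mul, Complex.norm_real,
        Real.norm_eq_abs]
      · exact mul_le_of_le_one_left (norm_nonneg _) (Real.abs_cos_le_one _)
      · exact mul_le_of_le_one_left (norm_nonneg _) (Real.abs_sin_le_one _)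
    have hsum := (tendsto_norm_zero.comp hα').add (tendsto_norm_zero.comp hβ0)
    rw [add_zero] at hsum
    exact tendsto_zero_iff_norm_tendsto_zero.2
      (squeeze_zero (fun x => norm_nonneg _) hbd hsum)
  · -- v′ − ωA cos θ = ω (−sin θ · α + cos θ · (β − A))
    have hβ0 : Tendsto (fun x => (Real.sin (w * x + θ₀) : ℂ) * v x + (Real.cos (w * x + θ₀) : ℂ) * v' x / w
        - A) atTop (𝓝 0) := by
      have := hA.sub_const A; rwa [sub_self] at this
    have hbd : ∀ x : ℝ, ‖(g x + x * deriv g x) - ((2 * π * lam : ℝ) : ℂ) * A *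
        (Real.cos (2 * π * lam * x + θ₀) : ℂ)‖ ≤
        |w| * (‖(Real.cos (w * x + θ₀) : ℂ) * v x - (Real.sin (w * x + θ₀) : ℂ) * v' x / w‖ +
        ‖(Real.sin (w * x + θ₀) : ℂ) * v x + (Real.cos (w * x + θ₀) : ℂ) * v' x / w - A‖) := by
      intro x
      have hrec := osc_reconstruct_deriv hw.ne' (w * x + θ₀) (v x) (v' x)
      have hident : (g x + x * deriv g x) - ((2 * π * lam : ℝ) : ℂ) * A *
          (Real.cos (2 * π * lam * x + θ₀) : ℂ) =
          (w : ℂ) * (-(Real.sin (w * x + θ₀) : ℂ) *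
            ((Real.cos (w * x + θ₀) : ℂ) * v x - (Real.sin (w * x + θ₀) : ℂ) * v' x / w) +
          (Real.cos (w * x + θ₀) : ℂ) *
            ((Real.sin (w * x + θ₀) : ℂ) * v x + (Real.cos (w * x + θ₀) : ℂ) * v' x / w - A)) := by
        have hv'x : v' x = g x + x * deriv g x := rfl
        rw [← hv'x, ← hw_def]
        linear_combination (-1 : ℂ) * hrec
      rw [hident, norm_mul, Complex.norm_real, Real.norm_eq_abs]
      refine mul_le_mul_of_nonneg_left ((norm_add_le _ _).trans (add_le_add ?_ ?_)) (abs_nonneg _)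
      · rw [norm_mul, norm_neg, Complex.norm_real, Real.norm_eq_abs]
        exact mul_le_of_le_one_left (norm_nonneg _) (Real.abs_sin_le_one _)
      · rw [norm_mul, Complex.norm_real, Real.norm_eq_abs]
        exact mul_le_of_le_one_left (norm_nonneg _) (Real.abs_cos_le_one _)
    have hsum := ((tendsto_norm_zero.comp hα').add (tendsto_norm_zero.comp hβ0)).const_mul |w|
    rw [add_zero, mul_zero] at hsum
    exact tendsto_zero_iff_norm_tendsto_zero.2
      (squeeze_zero (fun x => norm_nonneg _) hbd hsum)

/-- **Corollary 1.7 (ii), strong form for the boundary-condition representative** of an eigenvector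
of `W_sa`: a.e.-even ⇒ `x g(x) − A sin(2πλx) → 0` and `g + x g′ − 2πλ A cos(2πλx) → 0`; a.e.-odd ⇒
`x g(x) − A cos(2πλx) → 0` and `g + x g′ + 2πλ A sin(2πλx) → 0` (`+∞`).  Exported for the Green's
formula arguments at infinity (e.g. [ConnesMoscovici2022, Cor 2.2]).
[cite: ConnesMoscovici2022, Cor 1.7 (ii) (= arXiv:2112.05500 Cor 2.7, chunk p0006:L116–L123)] -/
theorem CM22_cor_1_7_strong (lam : ℝ) (hlam : 0 < lam) (W : L2R →ₗ.[ℂ] L2R) (hSA : IsProlateSA lam W)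
    (μ : ℝ) (φ : L2R) (hev : W.HasEigenvector (μ : ℂ) φ) :
    ∃ g : ℝ → ℂ, (φ : ℝ → ℂ) =ᵐ[volume] g ∧ ProlateBC lam g ∧
      ContDiffOn ℝ (⊤ : ℕ∞) g {x | x ≠ lam ∧ x ≠ -lam} ∧
      ((∀ᵐ x : ℝ, g (-x) = g x) → ∃ A : ℂ,
        Tendsto (fun x : ℝ => (x : ℂ) * g x - A * (Real.sin (2 * π * lam * x) : ℂ)) atTop (𝓝 0) ∧
        Tendsto (fun x : ℝ => (g x + x * deriv g x) -
          ((2 * π * lam : ℝ) : ℂ) * A * (Real.cos (2 * π * lam * x) : ℂ)) atTop (𝓝 0)) ∧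
      ((∀ᵐ x : ℝ, g (-x) = -g x) → ∃ A : ℂ,
        Tendsto (fun x : ℝ => (x : ℂ) * g x - A * (Real.cos (2 * π * lam * x) : ℂ)) atTop (𝓝 0) ∧
        Tendsto (fun x : ℝ => (g x + x * deriv g x) +
          ((2 * π * lam : ℝ) : ℂ) * A * (Real.sin (2 * π * lam * x) : ℂ)) atTop (𝓝 0)) := by
  obtain ⟨g, hfg, -, hbc, hsm⟩ := CM22_cor_1_7_i lam hlam W hSA μ φ hev
  obtain ⟨hφ, hW, -⟩ := exists_repr_of_hasEigenvector hSA hev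
  have hS := isOpen_ne_ne'' lam
  have hu : ∀ x ∈ {x : ℝ | x ≠ lam ∧ x ≠ -lam},
      HasDerivAt (fun y => pCoeff lam y * deriv g y) ((qCoeff lam x - μ) * g x) x :=
    fun x hx => hasDerivAt_pCoeff_mul_deriv_repr hlam hφ hW hfg hbc.differentiableOn hx.1 hx.2
  have hIoi : Ioi lam ⊆ {x : ℝ | x ≠ lam ∧ x ≠ -lam} := fun x hx =>
    ⟨ne_of_gt hx, by intro h; rw [h] at hx; exact absurd hx (by simp; linarith)⟩
  -- parity transfer (as in `CM22_cor_1_7_holds`)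
  have htransfer : ∀ (s : ℂ) (P : (ℝ → ℂ) → ℝ → ℂ) (B : ℝ → (ℝ → ℂ) → ℝ → ℂ),
      (P = evenFn ∧ s = 1 ∨ P = oddFn ∧ s = -1) → (B = bcInfEven ∨ B = bcInfOdd) →
      (∀ᵐ x : ℝ, g (-x) = s * g x) → Tendsto (B lam (P g)) atTop (𝓝 0) →
      Tendsto (B lam g) atTop (𝓝 0) := by
    intro s P B hP hB hae hT
    refine hT.congr' ?_
    filter_upwards [eventually_gt_atTop lam] with x hx
    have hpar := parity_of_ae hsm.continuousOn hae
    have h1 : P g =ᶠ[𝓝 x] g := by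
      filter_upwards [hS.mem_nhds (hIoi hx)] with y hy
      have hy' := hpar hy
      simp only at hy'
      rcases hP with ⟨rfl, rfl⟩ | ⟨rfl, rfl⟩
      · rw [evenFn, hy']; ring
      · rw [oddFn, hy']; ring
    have h2 : P g x = g x := h1.eq_of_nhds
    have h3 : deriv (P g) x = deriv g x := h1.deriv_eq
    rcases hB with rfl | rfl
    · rw [bcInfEven, bcInfEven, h2, h3]
    · rw [bcInfOdd, bcInfOdd, h2, h3]
  have hw : ((2 * π * lam : ℝ) : ℂ) ≠ 0 := Complex.ofReal_ne_zero.2 (by positivity)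
  refine ⟨g, hfg, hbc, hsm, fun heven => ?_, fun hodd => ?_⟩
  · have hae : ∀ᵐ x : ℝ, g (-x) = (1 : ℂ) * g x := by
      filter_upwards [heven] with x hx; rw [one_mul]; exact hx
    have hT : Tendsto (bcInfEven lam g) atTop (𝓝 0) :=
      htransfer 1 evenFn bcInfEven (Or.inl ⟨rfl, rfl⟩) (Or.inl rfl) hae hbc.evenTop
    have hα : Tendsto (fun x : ℝ => (Real.cos (2 * π * lam * x + 0) : ℂ) * (x * g x) -
        (Real.sin (2 * π * lam * x + 0) : ℂ) * (g x + x * deriv g x) / (2 * π * lam)) atTop (𝓝 0) := by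
      have h := hT.const_mul (-((2 * π * lam : ℝ) : ℂ))⁻¹
      rw [mul_zero] at h
      refine h.congr fun x => ?_
      rw [bcInfEven_eq_osc lam hlam g x, ← mul_assoc, inv_mul_cancel₀ (neg_ne_zero.2 hw), one_mul]
    obtain ⟨A, h1, h2⟩ := exists_tendsto_v_sub_of_osc_tendsto_zero hlam μ 0 hsm hu hα
    refine ⟨A, ?_, ?_⟩
    · simpa only [add_zero] using h1
    · simpa only [add_zero] using h2
  · have hae : ∀ᵐ x : ℝ, g (-x) = (-1 : ℂ) * g x := by
      filter_upwards [hodd] with x hx; rw [neg_one_mul]; exact hx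
    have hT : Tendsto (bcInfOdd lam g) atTop (𝓝 0) :=
      htransfer (-1) oddFn bcInfOdd (Or.inr ⟨rfl, rfl⟩) (Or.inr rfl) hae hbc.oddTop
    have hα : Tendsto (fun x : ℝ => (Real.cos (2 * π * lam * x + π / 2) : ℂ) * (x * g x) -
        (Real.sin (2 * π * lam * x + π / 2) : ℂ) * (g x + x * deriv g x) / (2 * π * lam))
        atTop (𝓝 0) := by
      have h := hT.const_mul (-((2 * π * lam : ℝ) : ℂ))⁻¹
      rw [mul_zero] at h
      refine h.congr fun x => ?_
      rw [bcInfOdd_eq_osc lam hlam g x, ← mul_assoc, inv_mul_cancel₀ (neg_ne_zero.2 hw), one_mul]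
    obtain ⟨A, h1, h2⟩ := exists_tendsto_v_sub_of_osc_tendsto_zero hlam μ (π / 2) hsm hu hα
    refine ⟨A, ?_, ?_⟩
    · simpa only [Real.sin_add_pi_div_two] using h1
    · have h2' := h2
      simp only [Real.cos_add_pi_div_two, Complex.ofReal_neg, mul_neg, sub_neg_eq_add] at h2'
      exact h2'

end Strong

end Literature.NumberTheory.ConnesMoscovici2022
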